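import Summits.ResolutionOfSingularities.ResolutionOfSingularities.Theorems.FrobeniusLadderFInjectiveMacaulayficationNonClosedPointChart
import Summits.ResolutionOfSingularities.ResolutionOfSingularities.Theorems.FrobeniusLadderFInjectiveMacaulayficationRegularOffFiniteOfLRAdm
import HarnessLib

/-!
# THE CLOSED-POINT RUNG UNDER (LR_adm): `ClosedPointLocalResolutionAdm p e` — local resolution at CLOSED points of `e`-folds over
# arbitrary fields of characteristic `p`, Temkin's (iii) category — and (LR_adm) FROM IT (crux `FInjectiveMacaulayfication`
# stmt-ResolutionOfSingularities-15315, chain w45a; res-L1-w45a-plan-1 GO 2026-08-28T02:24:33Z, shape (b) + (c); res-L1-w45a-tri-2 PRE-AUDIT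
# 02:24:02Z; seat res-L1-w45a-stub-3 g8)

[OURS · L1 W4.5a] Support file (`--supports stmt-ResolutionOfSingularities-15315 --as helper`); replaces the role of NO printed item;
NOT a statement of any manuscript; ONE definition (`@[conjecture] def`, OURS candidate, consumed only as a hypothesis; no instance, no
notation, no named fact) and its consumers; no `sorry`. AI-written (AI review is weaker than expert review). NOT in the cone of door
v36.2's `_proof`: it is the typed LADDER RUNG under the registered resolution-side stub (LR_adm)
`RegularOffFiniteOfLRAdm.LocalResolutionNonClosedGe4Adm` (p591519): **(LR_adm) = closed-point local Hironaka one dimension down, over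
finitely generated (imperfect) fields** — by `NonClosedPointChart.exists_closedPoint_model` a non-closed point `x` of a `d`-fold `X/k`
with `e = dim 𝒪_{X,x}` is a CLOSED point of an `e`-dimensional affine variety `Y` over `K = k(X₁,…,X_r)` with the same local ring, and
`e ≤ d − 1`.

* `ClosedPointLocalResolutionAdm p e` — [OURS · CANDIDATE statement] the (LR_adm) body (admissible blowing up of `Spec 𝒪_{Y,y}` regular
  off the closed fibre ⇒ admits a desingularization) at every CLOSED point `y` of every integral separated finite-type `Y` of dimension
  `e` over every field `K` of characteristic `p`. The binder carries neither the small field `k` nor `r = trdeg_k K`: the proofs never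
  use them (res-L1-w45a-plan-1: «drop k and r if the proof never uses them — then say so»); the rung's LEVEL is `e = dim Y`, and the
  well-foundedness bookkeeping is `localBody_at_nonClosed_of_closedPoint_lt` (only levels `4 ≤ e ≤ d − 1` are consumed on a `d`-fold).
  `K` ranges over ALL fields of characteristic `p` (res-L1-w45a-tri-2 caution (2): `k(X₁,…,X_r)` is imperfect; any fact later consumed
  at these closed points must be an arbitrary-field fact — evidence over perfect fields does not instantiate this rung).
* PROVED: `localBody_at_of_closedPoint` (the (LR_adm) body at ANY point of local dimension `e` from the rung at level `e`);
  **`localResolutionNonClosedGe4Adm_of_closedPoint : (∀ p e, p.Prime → 4 ≤ e → ClosedPointLocalResolutionAdm p e) → (LR_adm)`**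
  (d-uniform, as the registered stub is); `ringKrullDim_stalk_add_one_le_of_not_isClosed` + `localBody_at_nonClosed_of_closedPoint_lt`
  (per `d`-fold: levels `4 ≤ e ≤ d − 1` suffice at its non-closed points); `closedPointLocalResolutionAdm_of_localRes` (the rung is
  ≤ S_loc = `∀ K, Literature.…LocalBlowupsAdmitDesingularization (Spec K)`, Temkin 2008 Prop. 2.3.4 (iii), like every stub of v36.2).

[candidate statement, OURS; cite: Temkin2008, Prop. 2.3.4 (iii) and Def. 2.2.6; EGAIV2, §5–§6; GortzWedhorn2020, Thm. 5.22]
-/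

-- single-problem summit: the doubled namespace component is forced
set_option linter.dupNamespace false

noncomputable section

namespace Summit.ResolutionOfSingularities.ResolutionOfSingularities.Theorems.FInjectiveMacaulayfication.ClosedPointLocalResolutionAdm

open CategoryTheory AlgebraicGeometry TopologicalSpace IsLocalRing
open Literature.AlgebraicGeometry.Resolution
open Summit.ResolutionOfSingularities.ResolutionOfSingularities.Theorems.FInjectiveMacaulayfication

/-! ## §1 The closed-point rung -/

/-- [OURS · CANDIDATE statement] **`ClosedPointLocalResolutionAdm p e` — LOCAL RESOLUTION AT CLOSED POINTS OF `e`-FOLDS, Temkin's (iii)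
category.** For every field `K` of characteristic `p` (ARBITRARY — in the application `K = k(X₁,…,X_r)` is imperfect), every INTEGRAL
separated `K`-scheme `Y` of finite type with `dim Y = e`, and every CLOSED point `y ∈ Y`: every ADMISSIBLE blowing up
`g : S′ → Spec 𝒪_{Y,y}` (centre inside the singular locus) whose singular points all lie in the closed fibre admits a desingularization.
Consumed only for prime `p` and `e ≥ 4` (`localResolutionNonClosedGe4Adm_of_closedPoint`). [candidate statement, OURS; the (LR_adm) body of
`RegularOffFiniteOfLRAdm.LocalResolutionNonClosedGe4Adm` placed at a CLOSED point; cite: Temkin2008, Prop. 2.3.4 (iii); Def. 2.2.6] -/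
@[conjecture] def ClosedPointLocalResolutionAdm (p e : ℕ) : Prop :=
  ∀ (K : Type) [Field K] [CharP K p] (Y : Scheme.{0}) (g : Y ⟶ Spec (.of K)),
    IsSeparated g → LocallyOfFiniteType g → QuasiCompact g → IsIntegral Y → topologicalKrullDim Y = e →
    ∀ y : Y, IsClosed ({y} : Set Y) →
      ∀ (S' : Scheme.{0}) (g' : S' ⟶ Spec (Y.presheaf.stalk y)) (I : (Spec (Y.presheaf.stalk y)).IdealSheafData),
        IsBlowup g' I → ((I.support : Set _) ⊆ (Scheme.regularLocus (Spec (Y.presheaf.stalk y)))ᶜ) →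
        (∀ s : S', s ∉ Scheme.regularLocus S' → g'.base s = closedPoint (Y.presheaf.stalk y)) →
        Scheme.AdmitsDesingularization S'

/-! ## §2 The (LR_adm) body at ANY point of local dimension `e` from the closed-point rung at level `e` -/

/-- **The (LR_adm) body at a point `x` of local dimension `e` of a variety `X/k` follows from `ClosedPointLocalResolutionAdm p e`**:
`x` is a CLOSED point of the affine `K`-variety `Y` of `NonClosedPointChart.exists_closedPoint_model` (`K = k(X₁,…,X_r)`, `dim Y = e`)
with the SAME local ring, and the body moves along `𝒪_{X,x} ≅ 𝒪_{Y,y}` (`NonClosedPointChart.localBody_of_iso`). [OURS · reduction; folklore] -/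
theorem localBody_at_of_closedPoint (p : ℕ) {k : Type} [Field k] [CharP k p] {X : Scheme.{0}} (f : X ⟶ Spec (.of k))
    [LocallyOfFiniteType f] [IsIntegral X] (x : X) {e : ℕ} (he : ringKrullDim (X.presheaf.stalk x) = e)
    (h : ClosedPointLocalResolutionAdm p e) :
    ∀ (S' : Scheme.{0}) (g : S' ⟶ Spec (X.presheaf.stalk x)) (I : (Spec (X.presheaf.stalk x)).IdealSheafData),
      IsBlowup g I → ((I.support : Set _) ⊆ (Scheme.regularLocus (Spec (X.presheaf.stalk x)))ᶜ) →
      (∀ s : S', s ∉ Scheme.regularLocus S' → g.base s = closedPoint (X.presheaf.stalk x)) →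
      Scheme.AdmitsDesingularization S' := by
  obtain ⟨r, Y, gY, y, _, hint, hsep, hft, hqc, hycl, ⟨ε⟩, hdimY⟩ := NonClosedPointChart.exists_closedPoint_model p f x
  haveI := NonClosedPointChart.charP_fractionRing_mvPolynomial p k r
  have hdimY' : topologicalKrullDim Y = e := by rw [hdimY, he]
  exact NonClosedPointChart.localBody_of_iso ε (h _ Y gY hsep hft hqc hint hdimY' y hycl)

/-- **(LR_adm) ⟸ the closed-point rung at all levels `e ≥ 4`** (d-uniform, as the registered stub is): local resolution at NON-CLOSED
points of local dimension `≥ 4` of varieties over fields of characteristic `p` follows from local resolution at CLOSED points of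
`e`-folds, `e ≥ 4`, over (finitely generated, in general imperfect) fields of characteristic `p`. [OURS · reduction; folklore] -/
theorem localResolutionNonClosedGe4Adm_of_closedPoint
    (h : ∀ p e : ℕ, p.Prime → 4 ≤ e → ClosedPointLocalResolutionAdm p e) :
    RegularOffFiniteOfLRAdm.LocalResolutionNonClosedGe4Adm := by
  intro p hp k _ _ X f _ hl _ _ x _ h4 S' g I hg hI hfib
  haveI := hl
  haveI : IsLocallyNoetherian X := LocallyOfFiniteType.isLocallyNoetherian f
  obtain ⟨n, hn⟩ := exists_nat_cast_eq_ringKrullDim (R := X.presheaf.stalk x)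
  have h4n : 4 ≤ n := by rw [hn] at h4; exact_mod_cast h4
  exact localBody_at_of_closedPoint p f x hn (h p n hp h4n) S' g I hg hI hfib

/-! ## §3 The levels actually consumed at a non-closed point of a `d`-fold: `4 ≤ e ≤ d − 1` -/

/-- A NON-CLOSED point of an integral `d`-fold locally of finite type over a field has local dimension `≤ d − 1`.
[cite: GortzWedhorn2020, Thm. 5.22 (3)] -/
theorem ringKrullDim_stalk_add_one_le_of_not_isClosed {K : Type} [Field K] {X : Scheme.{0}} [IsIntegral X] (f : X ⟶ Spec (.of K))
    [LocallyOfFiniteType f] {d : ℕ} (hd : topologicalKrullDim X = d) (x : X) (hx : ¬ IsClosed ({x} : Set X)) :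
    ∃ e : ℕ, ringKrullDim (X.presheaf.stalk x) = e ∧ e + 1 ≤ d := by
  obtain ⟨e, h, he, hh, hsum⟩ := TerminationModClosedPoints.exists_ringKrullDim_stalk_add_height_eq f hd x
  refine ⟨e, he, ?_⟩
  have h0 : h ≠ 0 := by
    intro h0
    apply hx
    rw [TerminationModClosedPoints.isClosed_singleton_iff_height_eq_zero x, hh, h0]
    rfl
  omega

/-- **At the non-closed points of a `d`-fold only the closed-point rungs of levels `4 ≤ e ≤ d − 1` are consumed**: for `X/k` integral
separated of finite type with `dim X = d`, the (LR_adm) body at every non-closed `x` with `dim 𝒪_{X,x} ≥ 4` follows from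
`ClosedPointLocalResolutionAdm p e` for `4 ≤ e ≤ d − 1` — the rung sits STRICTLY BELOW level `d`. [OURS · reduction; folklore] -/
theorem localBody_at_nonClosed_of_closedPoint_lt (p : ℕ) {k : Type} [Field k] [CharP k p] {X : Scheme.{0}} (f : X ⟶ Spec (.of k))
    [LocallyOfFiniteType f] [IsIntegral X] {d : ℕ} (hd : topologicalKrullDim X = d)
    (h : ∀ e : ℕ, 4 ≤ e → e + 1 ≤ d → ClosedPointLocalResolutionAdm p e)
    (x : X) (hx : ¬ IsClosed ({x} : Set X)) (h4 : (4 : WithBot ℕ∞) ≤ ringKrullDim (X.presheaf.stalk x)) :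
    ∀ (S' : Scheme.{0}) (g : S' ⟶ Spec (X.presheaf.stalk x)) (I : (Spec (X.presheaf.stalk x)).IdealSheafData),
      IsBlowup g I → ((I.support : Set _) ⊆ (Scheme.regularLocus (Spec (X.presheaf.stalk x)))ᶜ) →
      (∀ s : S', s ∉ Scheme.regularLocus S' → g.base s = closedPoint (X.presheaf.stalk x)) →
      Scheme.AdmitsDesingularization S' := by
  obtain ⟨e, he, hed⟩ := ringKrullDim_stalk_add_one_le_of_not_isClosed f hd x hx
  have h4e : 4 ≤ e := by rw [he] at h4; exact_mod_cast h4
  exact localBody_at_of_closedPoint p f x he (h e h4e hed)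

/-! ## §4 The rung is at most local resolution (Temkin 2008, Prop. 2.3.4 (iii)) -/

/-- **S_loc ⇒ the closed-point rung** at every level: `ClosedPointLocalResolutionAdm p e` is a special case (closed points, admissible
centres, integral `Y`) of `Literature.…LocalBlowupsAdmitDesingularization (Spec K)` for all fields `K`. [cite: Temkin2008, Prop. 2.3.4 (iii)] -/
theorem closedPointLocalResolutionAdm_of_localRes
    (hT : ∀ (K : Type) [Field K], LocalBlowupsAdmitDesingularization (Spec (.of K))) (p e : ℕ) :
    ClosedPointLocalResolutionAdm p e := by
  intro K _ _ Y g _ hl hq _ _ y _ S' g' I hg' _ hfib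
  haveI := hl
  haveI := hq
  exact hT K Y g y inferInstance S' g' I hg' hfib

end Summit.ResolutionOfSingularities.ResolutionOfSingularities.Theorems.FInjectiveMacaulayfication.ClosedPointLocalResolutionAdm

end
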